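import Literature.InformationTheory.Coding.TernaryGolayCode
import Literature.InformationTheory.Coding.MacWilliamsIdentityPrimeField
import HarnessLib

/-!
# The weight enumerator of the ternary Golay code is MacWilliams-invariant
# (MacWilliams–Sloane Ch. 5 §6 Theorem 13 applied to the self-dual `𝒢₁₂`, Ch. 20 (74); Ch. 19 §2)

Layer `Literature/InformationTheory/Coding`, namespace `Literature.InformationTheory.Coding.TernaryGolayCode` (lane
`lit-hodgefound`, Layer A4, row A4-17; prover seat `lit-hodgefound-p23`; a rider joining the tree's
`TernaryGolayCode.lean` (`𝒢₁₂`: `card_code = 729`, `dualCode_eq_code`, the weight enumerator (74)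
`weightEnumerator_eq`) and `MacWilliamsIdentityPrimeField.lean` (Theorem 13 over `𝔽_p`,
`macWilliams_identity_zmod_of_selfDual`)).

* `macWilliams_selfDual` — since `𝒢₁₂⊥ = 𝒢₁₂` and `|𝒢₁₂| = 3⁶`: `729 · W_{𝒢₁₂}(x, y) = W_{𝒢₁₂}(x + 2y, x − y)`
  (Theorem 13 with `p = 3`), for complex `x, y`;
* `weightEnumerator_transform` — the same identity for the explicit polynomial (74),
  `(x+2y)¹² + 264 (x+2y)⁶(x−y)⁶ + 440 (x+2y)³(x−y)⁹ + 24 (x−y)¹² = 729 (x¹² + 264 x⁶y⁶ + 440 x³y⁹ + 24 y¹²)`, in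
  any commutative ring (so (74) is consistent with self-duality: the invariance under
  `(x, y) ↦ 3^{-1/2}(x + 2y, x − y)` that Gleason's theorem for ternary self-dual codes (Ch. 19 §2) takes as
  input).

## References

* F. J. MacWilliams, N. J. A. Sloane, *The Theory of Error-Correcting Codes*, North-Holland 1977, Ch. 5 §6
  Theorem 13 (47) (held chunk p0145); Ch. 20 §1 (74) (the weight enumerator of `𝒢₁₂`) (held chunk p0494);
  Ch. 19 §2 (Gleason's theorem, ternary case: invariance under `(x + 2y, x − y)/√3`).
-/

namespace Literature.InformationTheory.Coding

namespace TernaryGolayCode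

open Finset

/-- **`𝒢₁₂` is self-dual, so its weight enumerator satisfies `729 · W(x, y) = W(x + 2y, x − y)`** — Theorem 13
over `𝔽₃` (`W_{C⊥}(x,y) = |C|⁻¹ W_C(x + 2y, x − y)`) with `C⊥ = C = 𝒢₁₂`, `|C| = 729`.
[cite: MacWilliamsSloane1977, Ch. 5 §6 Theorem 13 (47) (p0145); Ch. 20 §1 ("𝒢₁₂ is self-dual") (p0494)] -/
theorem macWilliams_selfDual (x y : ℂ) :
    (729 : ℂ) * ∑ u ∈ code, x ^ (12 - (univ.filter fun i => u i ≠ 0).card) * y ^ (univ.filter fun i => u i ≠ 0).card =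
      ∑ u ∈ code, (x + 2 * y) ^ (12 - (univ.filter fun i => u i ≠ 0).card) *
        (x - y) ^ (univ.filter fun i => u i ≠ 0).card := by
  have h := macWilliams_identity_zmod_of_selfDual code (fun _ hc _ hc' => add_mem_code hc hc') dualCode_eq_code x y
  have h2 : ((3 : ℕ) : ℂ) - 1 = 2 := by norm_num
  have h729 : ((729 : ℕ) : ℂ) = 729 := by norm_num
  rw [card_code, h2, h729] at h
  exact h

/-- **The explicit enumerator (74) is MacWilliams-invariant**:
`(x+2y)¹² + 264(x+2y)⁶(x−y)⁶ + 440(x+2y)³(x−y)⁹ + 24(x−y)¹² = 729·(x¹² + 264x⁶y⁶ + 440x³y⁹ + 24y¹²)`.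
[cite: MacWilliamsSloane1977, Ch. 20 §1 (74) (p0494); Ch. 5 §6 Theorem 13 (47) (p0145)] -/
theorem weightEnumerator_transform {R : Type*} [CommRing R] (x y : R) :
    (x + 2 * y) ^ 12 + 264 * (x + 2 * y) ^ 6 * (x - y) ^ 6 + 440 * (x + 2 * y) ^ 3 * (x - y) ^ 9 +
        24 * (x - y) ^ 12 =
      729 * (x ^ 12 + 264 * x ^ 6 * y ^ 6 + 440 * x ^ 3 * y ^ 9 + 24 * y ^ 12) := by
  ring

/-- **Both sides evaluated**: `W_{𝒢₁₂}(x + 2y, x − y) = 729 · (x¹² + 264 x⁶y⁶ + 440 x³y⁹ + 24 y¹²)` as a sum over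
the code. [cite: MacWilliamsSloane1977, Ch. 20 §1 (74) (p0494); Ch. 5 §6 Theorem 13 (47) (p0145)] -/
theorem weightEnumerator_transform_eq (x y : ℂ) :
    ∑ u ∈ code, (x + 2 * y) ^ (12 - (univ.filter fun i => u i ≠ 0).card) *
        (x - y) ^ (univ.filter fun i => u i ≠ 0).card =
      729 * (x ^ 12 + 264 * x ^ 6 * y ^ 6 + 440 * x ^ 3 * y ^ 9 + 24 * y ^ 12) := by
  rw [← macWilliams_selfDual, weightEnumerator_eq]

end TernaryGolayCode

end Literature.InformationTheory.Coding
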